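import Mathlib.Tactic.Group
import Summits.MatrixMultiplication.MatrixMultiplication.Theses.GelfandPairHosts

/-!
# `SaturatedRealization` — quotient-form module designs are saturated TPP triples

Route `MatrixMultiplication/GelfandPairHosts`, item `stmt-MatrixMultiplication-7386` (support).
Let a finite group `G` act transitively on `X`, fix `x₀ : X`, and let `F, Hs ⊆ G`, `P ⊆ X` be a
*quotient-form design*: `(f'⁻¹ f h⁻¹ h') • p = p' ⟹ f = f' ∧ h = h' ∧ p = p'` for
`f, f' ∈ F`, `h, h' ∈ Hs`, `p, p' ∈ P`.  Then the subsets
`S = F⁻¹`, `T = Hs⁻¹`, `U = {g : g • x₀ ∈ P}` of `G` satisfy the triple product property of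
Cohn–Umans 2003, Def. 2.1 (tree: `Literature.Computability.AlgebraicComplexity.RealizesTPP`, the
`s s'⁻¹ · t t'⁻¹ · u u'⁻¹ = 1` form), and `|S| = |F|`, `|T| = |Hs|`, `|U| = |P| · |G_{x₀}|`
(the fibres of the orbit map `g ↦ g • x₀` over `P` are left cosets of the stabiliser).  Hence `G`
realizes `⟨|F|, |Hs|, |P| · |G_{x₀}|⟩`.

Proof of the TPP.  With `s = f'⁻¹`, `s' = f⁻¹`, `t = h⁻¹`, `t' = h'⁻¹` the relation
`s s'⁻¹ (t t'⁻¹) (u u'⁻¹) = 1` reads `f'⁻¹ f h⁻¹ h' = u' u⁻¹`; applying both sides to `u • x₀`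
gives `(f'⁻¹ f h⁻¹ h') • (u • x₀) = u' • x₀` with `u • x₀, u' • x₀ ∈ P`, so the design forces
`f = f'`, `h = h'`, and then the relation collapses to `u u'⁻¹ = 1`.
-/

-- single-conjunct summit: the mandated namespace `Summit.MatrixMultiplication.MatrixMultiplication.…`
-- repeats `MatrixMultiplication` (summit = sub-problem), which `linter.dupNamespace` would flag.
set_option linter.dupNamespace false

namespace Summit.MatrixMultiplication.MatrixMultiplication.Theorems

/-- Fibres of the orbit map are cosets of the stabiliser: if `p = g₀ • x₀` lies in the orbit of
`x₀`, then `{g : g • x₀ = p} = g₀ · G_{x₀}` has exactly `|G_{x₀}|` elements. [folklore] -/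
theorem SaturatedRealization_card_fibre {G : Type*} [Group G] [Fintype G] {X : Type*}
    [DecidableEq X] [MulAction G X] (x₀ p : X) (hp : ∃ g : G, g • x₀ = p) :
    (Finset.univ.filter fun g : G => g • x₀ = p).card = Nat.card (MulAction.stabilizer G x₀) := by
  classical
  obtain ⟨g₀, rfl⟩ := hp
  rw [Nat.card_eq_fintype_card, Fintype.card_subtype]
  have himg : (Finset.univ.filter fun g : G => g • x₀ = g₀ • x₀) =
      (Finset.univ.filter fun g : G => g ∈ MulAction.stabilizer G x₀).image (g₀ * ·) := by
    ext g
    simp only [Finset.mem_filter, Finset.mem_univ, true_and, Finset.mem_image,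
      MulAction.mem_stabilizer_iff]
    constructor
    · intro hg
      refine ⟨g₀⁻¹ * g, ?_, mul_inv_cancel_left g₀ g⟩
      rw [mul_smul, hg, inv_smul_smul]
    · rintro ⟨s, hs, rfl⟩
      rw [mul_smul, hs]
  rw [himg, Finset.card_image_of_injective _ (mul_right_injective g₀)]

/-- **Quotient-form designs are saturated TPP triples** (settles `stmt-MatrixMultiplication-7386`,
exact route signature
`Summit.MatrixMultiplication.MatrixMultiplication.Theses.GelfandPairHosts.SaturatedRealization`):
if `G` acts transitively on `X` and `F, Hs ⊆ G`, `P ⊆ X` satisfy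
`(f'⁻¹ f h⁻¹ h') • p = p' ⟹ f = f' ∧ h = h' ∧ p = p'`, then `(F⁻¹, Hs⁻¹, {g : g • x₀ ∈ P})`
has the triple product property (Cohn–Umans 2003, Def. 2.1), so `G` realizes
`⟨|F|, |Hs|, |P| · |G_{x₀}|⟩`.  The third leg is `G_{x₀}`-saturated, whence its size: the orbit
map has fibres of size `|G_{x₀}|` over each point of `P`. [cite: CohnUmans2003, Def. 2.1] -/
theorem SaturatedRealization_proof :
    Summit.MatrixMultiplication.MatrixMultiplication.Theses.GelfandPairHosts.SaturatedRealization := by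
  unfold Summit.MatrixMultiplication.MatrixMultiplication.Theses.GelfandPairHosts.SaturatedRealization
  intro G _ _ X _ _ _ x₀ F Hs P htrans hdes
  classical
  refine ⟨F.image (·⁻¹), Hs.image (·⁻¹), Finset.univ.filter (fun g : G => g • x₀ ∈ P),
    Finset.card_image_of_injective _ inv_injective,
    Finset.card_image_of_injective _ inv_injective, ?_, ?_⟩
  · -- `|U| = |P| · |G_{x₀}|`: sum the fibres of the orbit map over `P`
    have hmaps : Set.MapsTo (fun g : G => g • x₀)
        ↑(Finset.univ.filter fun g : G => g • x₀ ∈ P) ↑P := fun g hg =>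
      Finset.mem_coe.mpr (Finset.mem_filter.mp (Finset.mem_coe.mp hg)).2
    rw [Finset.card_eq_sum_card_fiberwise hmaps]
    refine Finset.sum_const_nat fun p hp => ?_
    rw [Finset.filter_filter, ← SaturatedRealization_card_fibre x₀ p (htrans p)]
    congr 1
    refine Finset.filter_congr fun g _ => ?_
    exact ⟨fun hg => hg.2, fun hg => ⟨by rw [hg]; exact hp, hg⟩⟩
  · -- the triple product property
    intro s hs s' hs' t ht t' ht' u hu u' hu' heq
    simp only [Finset.mem_image] at hs hs' ht ht'
    obtain ⟨f', hf', rfl⟩ := hs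
    obtain ⟨f, hf, rfl⟩ := hs'
    obtain ⟨h, hh, rfl⟩ := ht
    obtain ⟨h', hh', rfl⟩ := ht'
    simp only [Finset.mem_filter, Finset.mem_univ, true_and] at hu hu'
    simp only [inv_inv] at heq
    -- `heq : f'⁻¹ * f * (h⁻¹ * h') * (u * u'⁻¹) = 1`
    have hgrp : f'⁻¹ * f * h⁻¹ * h' = u' * u⁻¹ := by
      calc f'⁻¹ * f * h⁻¹ * h'
          = f'⁻¹ * f * (h⁻¹ * h') * (u * u'⁻¹) * (u' * u⁻¹) := by group
        _ = u' * u⁻¹ := by rw [heq, one_mul]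
    have key : (f'⁻¹ * f * h⁻¹ * h') • (u • x₀) = u' • x₀ := by
      rw [hgrp, mul_smul, inv_smul_smul]
    obtain ⟨hff, hhh, -⟩ := hdes f hf f' hf' h hh h' hh' _ hu _ hu' key
    subst hff hhh
    refine ⟨rfl, rfl, ?_⟩
    simpa [mul_inv_eq_one] using heq

end Summit.MatrixMultiplication.MatrixMultiplication.Theorems
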